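/-
Copyright: the b2b-balaban T⁴-continuum CRUX team, row NE7b leaf lineage `t4-ne7b-formalise-leaf-06` (gen 152). Project licence.
-/
import Summits.QuantumFields.BalabanUV.T4Continuum.Spine.NE7b.ConvexWindowSuppliersLocal

/-!
# THE THIRD-DERIVATIVE TABLE OF A SUM OF LOCAL TERMS IS INTENSIVE: for `P = Σ_p Φ_p ∘ L_p` with linear readings `L_p` and
# `Φ_p ∈ C³(U_p)` ONLY, `D³P(z)[u,v,w] = Σ_p D³Φ_p(L_p z)[L_p u, L_p v, L_p w]` at every `z` read into the `U_p`; for COORDINATE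
# readings of supports `S_p` the entry `D³P(z)[e_a,e_b,e_c]` sees only the terms with `a, b, c ∈ S_p`, so every fibre sum of the table is
# `≤ Σ_{p ∋ j} |S_p|²·τ_p ≤ d·s²·τ` — the `hrow`∕`hcol` letters of `…ConvexWindowSuppliersLocal.thirdDeriv_supNorm_of_fibreSums` SUPPLIED
# from per-term data (support size `s`, overlap `d`, per-term bound `τ`), with no global `C³` anywhere
# (row NE7b, node U5c; letter (ℓ1) of the windowed road, the READING supplier next to `…WindowHessianFromThirdDerivReading`; [folklore])

Cell `pub-balaban`, sub-cell `t4`, spine estimate NE7b (`T4WeightBudget.RelWeightBound`; the cell's OWN estimate — NOT PRINTED in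
[Bałaban 1983–89], NOT PROVED).  Crux-route work under `Spine/NE7b/` by a row leaf on the convexity road; NOTHING of Bałaban's is
named, valued or asserted; no `T4Continuum/Support` leaf typed; no `def`; zero `sorry`.  Import: leaf-02's `…ConvexWindowSuppliersLocal`
(the Schur reading `thirdDeriv_supNorm_of_fibreSums`, BY NAME — it carries no regularity hypothesis) and, through it, Mathlib.

WHY.  The intensive constant of the reading road (`…ConvexWindowSuppliersLocal`: `‖D³P(z)[w,·,·]‖_op ≤ M·‖w‖_∞` with `M` a FIBRE SUM of the
third-derivative entries — refuter κ-ne7bref-g72-4 ∕ F453 ∕ F463 «each direction meets O(1) plaquettes») is stated for ONE function `P` whose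
table is DISPLAYED (`hrow`∕`hcol`, or `hsupp`∕`hτb` for one interaction set).  Print's perturbation is a SUM of local terms, each a functional
of the few coordinates of one plaquette ∕ cube, each `C³` (indeed analytic) only NEAR the window; the analytic suppliers of this lineage
(`…AnalyticThirdDerivLetter[Local]`) bound ONE term's table by `27M∕δ³`.  THIS FILE is the bookkeeping in between, with every regularity
hypothesis ON the `U_p`: the table of the sum is the sum of the tables read through the `L_p` (§1–§2, Mathlib's
`ContinuousLinearMap.iteratedFDerivWithin_comp_right` on the open preimages + `iteratedFDeriv_sum_apply` AT points), a coordinate reading kills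
every entry with an index outside its support (§3), so the fibre sums are bounded by the LOCAL data `(|S_p|, τ_p)` and the overlap `d` (§4) —
and leaf-02's Schur reading turns them into the letter the `ContDiffOn` window companion `…WindowHessianFromThirdDerivReading` §4 consumes
(§5; that last junction is one `exact`, kept as a certificate until both files have hub oleans).

WHAT IS PROVED ([folklore]; `𝔓` a finite index type of terms; `E`, `G_p` real normed spaces, `L_p : E →L[ℝ] G_p`, `U_p ⊆ G_p` open,
`Φ_p : G_p → ℝ` with `ContDiffOn ℝ k (Φ_p) (U_p)`; from §3 on `E = EuclideanSpace ℝ (Fin n)`, `G_p = EuclideanSpace ℝ (S_p)` and `L_p = π_p` a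
COORDINATE READING of the support `S_p ⊆ Fin n` (`(π_p v)_i = v_i` for `i ∈ S_p`); `e_a = EuclideanSpace.single a 1`):
* §1 ONE TERM: **`iteratedFDeriv_comp_clm_apply`** (`L z ∈ U` ⟹ `Dᵏ(Φ ∘ L)(z)[m] = DᵏΦ(L z)[L ∘ m]`), `iteratedFDeriv_comp_clm_eq_zero`
  (an argument with `L (m s) = 0` kills the entry), `norm_iteratedFDeriv_comp_clm_le` (`≤ ‖DᵏΦ(L z)‖·Π_s ‖L (m s)‖`), `contDiffAt_comp_clm`.
* §2 THE SUM: **`iteratedFDeriv_localTerms_apply`** (`∀ p, L_p z ∈ U_p` ⟹ `Dᵏ(Σ_p Φ_p ∘ L_p)(z)[m] = Σ_p DᵏΦ_p(L_p z)[L_p ∘ m]`),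
  `isOpen_localDomain` ∕ `contDiffOn_localTerms` (the sum is `Cᵏ` on the open `{z | ∀ p, L_p z ∈ U_p}`).
* §3 COORDINATE READINGS: `norm_coordReading_le` (`‖π v‖ ≤ ‖v‖`), `coordReading_single_eq_zero` (`a ∉ S` ⟹ `π e_a = 0`),
  `norm_coordReading_single_le` (`≤ 1`), **`abs_iteratedFDeriv_three_single_localTerms_le`** (`‖D³Φ_p(π_p z)‖ ≤ τ_p` for all `p` ⟹
  `|D³P(z)[e_a,e_b,e_c]| ≤ Σ_{p : a,b,c ∈ S_p} τ_p`).
* §4 FIBRE SUMS: `card_filter_triples_le` (the triples through a fixed middle ∕ last index inside `S_p³` number `≤ |S_p|²`),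
  **`fibreSum_localTerms_le`** (every middle- and last-index fibre sum of the table `≤ Σ_p 1[j ∈ S_p]·|S_p|²·τ_p`) and
  **`fibreSum_localTerms_le_uniform`** (`|S_p| ≤ s`, `τ_p ≤ τ`, every coordinate in at most `d` supports ⟹ `≤ d·s²·τ`).
* §5 THE READING LETTER, leaf-02's Schur test BY NAME: **`thirdDeriv_supNorm_of_localTerms`** (`∀ z ∈ K, ‖D³P(z)[w,·,·]‖_op ≤ (d·s²·τ)·‖w‖_∞`
  for any `K ⊆ {z | ∀ p, π_p z ∈ U_p}` on which the per-term bounds hold) — the `hP3` letter of `…WindowHessianFromThirdDerivReading` §4 ∕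
  `…ConvexWindowSuppliersBox` §1–§3 with `c = d·s²·τ` INTENSIVE (no `n`, no `√n`); `contDiffOn_three_localTerms` (the sum is `C³` on the
  open `{z | ∀ p, π_p z ∈ U_p}` — the window companion's `ContDiffOn ℝ 3 P U` ∕ `IsOpen U` hypotheses, so the junction there is one `exact`).
* §6 toy (kernel): the count of §4 at `n = 2`, `S = univ`, middle slot (`example`).

NOT HERE (honest): the per-term bound `τ_p` itself (this lineage's `…AnalyticThirdDerivLetter.norm_iteratedFDeriv_three_chart_le`: `27M_p∕δ_p³`
through a contractive chart — composed by one `exact` once oleans exist), the numbers `s, d, τ` and the supports for Bałaban's steps ((A3) ∕ (A1c),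
NC-NE7b-α UNRULED), block (non-coordinate) readings (`…ConvexWindowSuppliersLocal` §5's block Schur test — same §1–§2, a v1.x on request),
mass-insertion power counting of unsubtracted inherited terms (refuter R-AHL-g83-1 (c)); anything of Bałaban's.  BY-NAME EFFECT ON THE WALL:
NONE (a socket-side supplier).  NE7b NOT PRINTED ∕ NOT PROVED; spine PROVED 0∕9; rung (B)+1 on a FINITE torus — NOT infinite volume, NOT the
mass gap, NOT Clay.
HONEST DEPENDENCY: continuum YM on T⁴ ⇐ BetaPertH ∧ nine spine estimates (0/9 proved); BetaPertH ⇐ (D1) ∧ (D4) ∧ CAP+tail; G-an2-4 gates asym,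
D1 and NE2∕3∕4.
-/

set_option autoImplicit false

noncomputable section

open Set Finset
open Summit.QuantumFields.BalabanUV.T4Continuum.NE7b.ConvexWindowSuppliersLocal

namespace Summit.QuantumFields.BalabanUV.T4Continuum.NE7b.ThirdDerivLocalTerms

/-! ## §1 One local term through a linear reading, `Φ ∈ Cᵏ(U)` only -/

section OneTerm

variable {E : Type*} [NormedAddCommGroup E] [NormedSpace ℝ E] {G : Type*} [NormedAddCommGroup G] [NormedSpace ℝ G]
  {F : Type*} [NormedAddCommGroup F] [NormedSpace ℝ F]

/-- **THE `k`-TH DERIVATIVE OF `Φ ∘ L` AT A POINT READ INTO THE SMOOTHNESS DOMAIN**: `L : E →L G` continuous linear, `U ⊆ G` open,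
`Φ ∈ Cᵏ(U)`, `L z ∈ U` ⟹ `Dᵏ(Φ ∘ L)(z)[m_0,…,m_{k−1}] = DᵏΦ(L z)[L m_0,…,L m_{k−1}]` (Mathlib's `iteratedFDerivWithin_comp_right` on the open
preimage `L⁻¹U`, read back to `iteratedFDeriv` on both open sets). [folklore] -/
theorem iteratedFDeriv_comp_clm_apply (L : E →L[ℝ] G) {Φ : G → F} {U : Set G} (hU : IsOpen U) {k : ℕ} (hΦ : ContDiffOn ℝ k Φ U)
    {z : E} (hz : L z ∈ U) (m : Fin k → E) :
    iteratedFDeriv ℝ k (Φ ∘ L) z m = iteratedFDeriv ℝ k Φ (L z) (fun s => L (m s)) := by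
  have hLo : IsOpen (L ⁻¹' U) := hU.preimage L.continuous
  have e1 : iteratedFDeriv ℝ k (Φ ∘ L) z = iteratedFDerivWithin ℝ k (Φ ∘ L) (L ⁻¹' U) z :=
    (iteratedFDerivWithin_of_isOpen k hLo hz).symm
  have e2 := L.iteratedFDerivWithin_comp_right hΦ hU.uniqueDiffOn hLo.uniqueDiffOn hz (i := k) le_rfl
  have e3 : iteratedFDerivWithin ℝ k Φ U (L z) = iteratedFDeriv ℝ k Φ (L z) := iteratedFDerivWithin_of_isOpen k hU hz
  rw [e1, e2, ContinuousMultilinearMap.compContinuousLinearMap_apply, e3]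

/-- **A KILLED ENTRY**: if one argument is read to zero (`L (m s) = 0`), the entry `Dᵏ(Φ ∘ L)(z)[m]` vanishes. [folklore] -/
theorem iteratedFDeriv_comp_clm_eq_zero (L : E →L[ℝ] G) {Φ : G → F} {U : Set G} (hU : IsOpen U) {k : ℕ} (hΦ : ContDiffOn ℝ k Φ U)
    {z : E} (hz : L z ∈ U) (m : Fin k → E) {s : Fin k} (hs : L (m s) = 0) :
    iteratedFDeriv ℝ k (Φ ∘ L) z m = 0 := by
  rw [iteratedFDeriv_comp_clm_apply L hU hΦ hz m]
  exact (iteratedFDeriv ℝ k Φ (L z)).map_coord_zero s hs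

/-- **THE ENTRY IS BOUNDED BY THE TERM's OWN DERIVATIVE NORM AND THE READ ARGUMENTS**:
`‖Dᵏ(Φ ∘ L)(z)[m]‖ ≤ ‖DᵏΦ(L z)‖·Π_s ‖L (m s)‖`. [folklore] -/
theorem norm_iteratedFDeriv_comp_clm_le (L : E →L[ℝ] G) {Φ : G → F} {U : Set G} (hU : IsOpen U) {k : ℕ} (hΦ : ContDiffOn ℝ k Φ U)
    {z : E} (hz : L z ∈ U) (m : Fin k → E) :
    ‖iteratedFDeriv ℝ k (Φ ∘ L) z m‖ ≤ ‖iteratedFDeriv ℝ k Φ (L z)‖ * ∏ s, ‖L (m s)‖ := by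
  rw [iteratedFDeriv_comp_clm_apply L hU hΦ hz m]
  exact (iteratedFDeriv ℝ k Φ (L z)).le_opNorm _

/-- The composite is `Cᵏ` AT every point read into `U`. [folklore] -/
theorem contDiffAt_comp_clm (L : E →L[ℝ] G) {Φ : G → F} {U : Set G} (hU : IsOpen U) {k : ℕ} (hΦ : ContDiffOn ℝ k Φ U)
    {z : E} (hz : L z ∈ U) : ContDiffAt ℝ k (Φ ∘ L) z :=
  (hΦ.contDiffAt (hU.mem_nhds hz)).comp z L.contDiff.contDiffAt

end OneTerm

/-! ## §2 A finite sum of local terms: the table of the sum is the sum of the read tables -/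

section Sum

variable {E : Type*} [NormedAddCommGroup E] [NormedSpace ℝ E] {𝔓 : Type*} [Fintype 𝔓]
  {G : 𝔓 → Type*} [∀ p, NormedAddCommGroup (G p)] [∀ p, NormedSpace ℝ (G p)]

/-- **THE `k`-TH DERIVATIVE OF A SUM OF LOCAL TERMS** `P = Σ_p Φ_p ∘ L_p`, `Φ_p ∈ Cᵏ(U_p)`, at a point `z` with `L_p z ∈ U_p` for every `p`:
`DᵏP(z)[m] = Σ_p DᵏΦ_p(L_p z)[L_p ∘ m]` (Mathlib's `iteratedFDeriv_sum_apply` AT the point + §1 termwise). [folklore] -/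
theorem iteratedFDeriv_localTerms_apply (L : (p : 𝔓) → (E →L[ℝ] G p)) (Φ : (p : 𝔓) → G p → ℝ) (U : (p : 𝔓) → Set (G p))
    (hU : ∀ p, IsOpen (U p)) {k : ℕ} (hΦ : ∀ p, ContDiffOn ℝ k (Φ p) (U p)) {z : E} (hz : ∀ p, L p z ∈ U p) (m : Fin k → E) :
    iteratedFDeriv ℝ k (fun x => ∑ p, Φ p (L p x)) z m = ∑ p, iteratedFDeriv ℝ k (Φ p) (L p z) (fun s => L p (m s)) := by
  have hterm : ∀ p ∈ (univ : Finset 𝔓), ContDiffAt ℝ k (fun x => Φ p (L p x)) z :=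
    fun p _ => contDiffAt_comp_clm (L p) (hU p) (hΦ p) (hz p)
  rw [iteratedFDeriv_fun_sum_apply hterm, _root_.sum_apply]
  exact Finset.sum_congr rfl fun p _ => iteratedFDeriv_comp_clm_apply (L p) (hU p) (hΦ p) (hz p) m

omit [Fintype 𝔓] in
/-- The natural domain `{z | ∀ p, L_p z ∈ U_p}` of the sum is open (finite intersection of open preimages). [folklore] -/
theorem isOpen_localDomain [Finite 𝔓] (L : (p : 𝔓) → (E →L[ℝ] G p)) (U : (p : 𝔓) → Set (G p)) (hU : ∀ p, IsOpen (U p)) :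
    IsOpen {z : E | ∀ p, L p z ∈ U p} := by
  have e : {z : E | ∀ p, L p z ∈ U p} = ⋂ p, (L p) ⁻¹' (U p) := by ext z; simp
  rw [e]
  exact isOpen_iInter_of_finite fun p => (hU p).preimage (L p).continuous

/-- The sum is `Cᵏ` on its natural domain. [folklore] -/
theorem contDiffOn_localTerms (L : (p : 𝔓) → (E →L[ℝ] G p)) (Φ : (p : 𝔓) → G p → ℝ) (U : (p : 𝔓) → Set (G p))
    (hU : ∀ p, IsOpen (U p)) {k : ℕ} (hΦ : ∀ p, ContDiffOn ℝ k (Φ p) (U p)) :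
    ContDiffOn ℝ k (fun x => ∑ p, Φ p (L p x)) {z : E | ∀ p, L p z ∈ U p} :=
  fun _ hz => (ContDiffAt.sum fun p _ => contDiffAt_comp_clm (L p) (hU p) (hΦ p) (hz p)).contDiffWithinAt

end Sum

/-! ## §3 Coordinate readings on `EuclideanSpace ℝ (Fin n)`: an index outside the support kills the entry -/

section Coord

variable {n : ℕ}

/-- **A COORDINATE READING IS A CONTRACTION**: `(π v)_i = v_i` for `i ∈ S` ⟹ `‖π v‖ ≤ ‖v‖` (`‖π v‖² = Σ_{i ∈ S} v_i² ≤ Σ_i v_i²`). [folklore] -/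
theorem norm_coordReading_le (S : Finset (Fin n)) (π : EuclideanSpace ℝ (Fin n) →L[ℝ] EuclideanSpace ℝ S)
    (hπ : ∀ (v : EuclideanSpace ℝ (Fin n)) (i : S), π v i = v i) (v : EuclideanSpace ℝ (Fin n)) : ‖π v‖ ≤ ‖v‖ := by
  have h1 : ‖π v‖ ^ 2 = ∑ i ∈ S, v i ^ 2 := by
    rw [EuclideanSpace.real_norm_sq_eq, ← Finset.sum_coe_sort S (fun i => v i ^ 2)]
    exact Finset.sum_congr rfl fun i _ => by rw [hπ v i]
  have h2 : ‖v‖ ^ 2 = ∑ i, v i ^ 2 := EuclideanSpace.real_norm_sq_eq v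
  have h3 : ∑ i ∈ S, v i ^ 2 ≤ ∑ i, v i ^ 2 :=
    Finset.sum_le_sum_of_subset_of_nonneg (Finset.subset_univ S) fun i _ _ => sq_nonneg _
  exact (pow_le_pow_iff_left₀ (norm_nonneg _) (norm_nonneg _) two_ne_zero).1 (by rw [h1, h2]; exact h3)

/-- **AN INDEX OUTSIDE THE SUPPORT IS READ TO ZERO**: `a ∉ S` ⟹ `π e_a = 0`. [folklore] -/
theorem coordReading_single_eq_zero (S : Finset (Fin n)) (π : EuclideanSpace ℝ (Fin n) →L[ℝ] EuclideanSpace ℝ S)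
    (hπ : ∀ (v : EuclideanSpace ℝ (Fin n)) (i : S), π v i = v i) {a : Fin n} (ha : a ∉ S) :
    π (EuclideanSpace.single a (1 : ℝ)) = 0 := by
  have h0 : ‖π (EuclideanSpace.single a (1 : ℝ))‖ ^ 2 = 0 := by
    rw [EuclideanSpace.real_norm_sq_eq]
    refine Finset.sum_eq_zero fun i _ => ?_
    have hi : (i : Fin n) ≠ a := fun h => ha (h ▸ i.2)
    rw [hπ, PiLp.single_apply, if_neg hi]
    simp
  simpa using h0

/-- A coordinate reading of a unit coordinate vector has norm `≤ 1`. [folklore] -/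
theorem norm_coordReading_single_le (S : Finset (Fin n)) (π : EuclideanSpace ℝ (Fin n) →L[ℝ] EuclideanSpace ℝ S)
    (hπ : ∀ (v : EuclideanSpace ℝ (Fin n)) (i : S), π v i = v i) (a : Fin n) :
    ‖π (EuclideanSpace.single a (1 : ℝ))‖ ≤ 1 := by
  refine (norm_coordReading_le S π hπ _).trans ?_
  rw [PiLp.norm_single, norm_one]

variable {𝔓 : Type*} [Fintype 𝔓]

/-- **THE ENTRY OF A SUM OF COORDINATE-LOCAL TERMS SEES ONLY THE TERMS CONTAINING ALL THREE INDICES.**  `P = Σ_p Φ_p ∘ π_p` with `π_p` a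
coordinate reading of `S_p`, `Φ_p ∈ C³(U_p)`, `π_p z ∈ U_p` and `‖D³Φ_p(π_p z)‖ ≤ τ_p` (`0 ≤ τ_p`) for every `p` ⟹ for every index triple `r`,
`|D³P(z)[e_{r0}, e_{r1}, e_{r2}]| ≤ Σ_{p : ∀ s, r s ∈ S_p} τ_p`. [folklore] -/
theorem abs_iteratedFDeriv_three_single_localTerms_le (S : 𝔓 → Finset (Fin n))
    (π : (p : 𝔓) → (EuclideanSpace ℝ (Fin n) →L[ℝ] EuclideanSpace ℝ (S p)))
    (hπ : ∀ p (v : EuclideanSpace ℝ (Fin n)) (i : S p), π p v i = v i) (Φ : (p : 𝔓) → EuclideanSpace ℝ (S p) → ℝ)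
    (U : (p : 𝔓) → Set (EuclideanSpace ℝ (S p))) (hU : ∀ p, IsOpen (U p)) (hΦ : ∀ p, ContDiffOn ℝ 3 (Φ p) (U p))
    {z : EuclideanSpace ℝ (Fin n)} (hz : ∀ p, π p z ∈ U p) (τ : 𝔓 → ℝ) (hτ0 : ∀ p, 0 ≤ τ p)
    (hτ : ∀ p, ‖iteratedFDeriv ℝ 3 (Φ p) (π p z)‖ ≤ τ p) (r : Fin 3 → Fin n) :
    |iteratedFDeriv ℝ 3 (fun x => ∑ p, Φ p (π p x)) z (fun s => EuclideanSpace.single (r s) (1 : ℝ))|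
      ≤ ∑ p ∈ univ.filter (fun p => ∀ s, r s ∈ S p), τ p := by
  rw [iteratedFDeriv_localTerms_apply π Φ U hU hΦ hz]
  refine (Finset.abs_sum_le_sum_abs _ _).trans ?_
  -- split the terms: those whose support contains every index, and the rest (which vanish)
  rw [← Finset.sum_filter_add_sum_filter_not univ (fun p => ∀ s, r s ∈ S p)]
  have hzero : ∑ p ∈ univ.filter (fun p => ¬ ∀ s, r s ∈ S p),
      |iteratedFDeriv ℝ 3 (Φ p) (π p z) (fun s => π p (EuclideanSpace.single (r s) (1 : ℝ)))| = 0 := by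
    refine Finset.sum_eq_zero fun p hp => ?_
    rw [Finset.mem_filter] at hp
    obtain ⟨s, hs⟩ := not_forall.1 hp.2
    rw [(iteratedFDeriv ℝ 3 (Φ p) (π p z)).map_coord_zero s (coordReading_single_eq_zero (S p) (π p) (hπ p) hs),
      abs_zero]
  rw [hzero, add_zero]
  refine Finset.sum_le_sum fun p _ => ?_
  have hle := (iteratedFDeriv ℝ 3 (Φ p) (π p z)).le_opNorm (fun s => π p (EuclideanSpace.single (r s) (1 : ℝ)))
  have hprod : ∏ s, ‖π p (EuclideanSpace.single (r s) (1 : ℝ))‖ ≤ 1 := by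
    calc ∏ s, ‖π p (EuclideanSpace.single (r s) (1 : ℝ))‖ ≤ ∏ _s : Fin 3, (1 : ℝ) :=
          Finset.prod_le_prod (fun s _ => norm_nonneg _) fun s _ => norm_coordReading_single_le (S p) (π p) (hπ p) (r s)
      _ = 1 := by simp
  rw [← Real.norm_eq_abs]
  calc ‖iteratedFDeriv ℝ 3 (Φ p) (π p z) (fun s => π p (EuclideanSpace.single (r s) (1 : ℝ)))‖
      ≤ ‖iteratedFDeriv ℝ 3 (Φ p) (π p z)‖ * ∏ s, ‖π p (EuclideanSpace.single (r s) (1 : ℝ))‖ := hle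
    _ ≤ τ p * 1 := mul_le_mul (hτ p) hprod (Finset.prod_nonneg fun s _ => norm_nonneg _) (hτ0 p)
    _ = τ p := mul_one _

end Coord

/-! ## §4 Fibre sums of the table from the local data `(|S_p|, τ_p)` and the overlap -/

section Fibre

variable {n : ℕ} {𝔓 : Type*} [Fintype 𝔓]

/-- **COUNTING**: the index triples through a fixed `s`-th index with all three indices in `S` number at most `|S|²` (they inject into `S × S` by
the two remaining indices; and there are none unless that fixed index lies in `S`). [folklore] -/
theorem card_filter_triples_le (S : Finset (Fin n)) (s : Fin 3) (j : Fin n) :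
    ((univ.filter (fun r : Fin 3 → Fin n => r s = j ∧ ∀ t, r t ∈ S)).card : ℝ) ≤ (if j ∈ S then (S.card : ℝ) ^ 2 else 0) := by
  split_ifs with hj
  · -- inject into `S ×ˢ S` by the two indices other than `s`
    obtain ⟨t₁, t₂, ht₁, ht₂, h12, hcover⟩ : ∃ t₁ t₂ : Fin 3, t₁ ≠ s ∧ t₂ ≠ s ∧ t₁ ≠ t₂ ∧ ∀ t, t = s ∨ t = t₁ ∨ t = t₂ := by
      fin_cases s
      · exact ⟨1, 2, by decide, by decide, by decide, by decide⟩
      · exact ⟨0, 2, by decide, by decide, by decide, by decide⟩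
      · exact ⟨0, 1, by decide, by decide, by decide, by decide⟩
    have hinj : Set.InjOn (fun r : Fin 3 → Fin n => (r t₁, r t₂))
        ↑(univ.filter (fun r : Fin 3 → Fin n => r s = j ∧ ∀ t, r t ∈ S)) := by
      intro r hr r' hr' h
      simp only [Finset.coe_filter, Set.mem_setOf_eq, Finset.mem_univ, true_and] at hr hr'
      simp only [Prod.mk.injEq] at h
      funext t
      rcases hcover t with rfl | rfl | rfl
      · rw [hr.1, hr'.1]
      · exact h.1
      · exact h.2
    have hmaps : Set.MapsTo (fun r : Fin 3 → Fin n => (r t₁, r t₂))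
        ↑(univ.filter (fun r : Fin 3 → Fin n => r s = j ∧ ∀ t, r t ∈ S)) ↑(S ×ˢ S) := by
      intro r hr
      simp only [Finset.coe_filter, Set.mem_setOf_eq, Finset.mem_univ, true_and] at hr
      simp only [Finset.coe_product, Set.mem_prod, Finset.mem_coe]
      exact ⟨hr.2 t₁, hr.2 t₂⟩
    have hc := Finset.card_le_card_of_injOn _ hmaps hinj
    rw [Finset.card_product] at hc
    rw [pow_two]
    exact_mod_cast hc
  · have he : univ.filter (fun r : Fin 3 → Fin n => r s = j ∧ ∀ t, r t ∈ S) = ∅ := by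
      refine Finset.filter_eq_empty_iff.2 fun r _ h => hj ?_
      rw [← h.1]; exact h.2 s
    rw [he, Finset.card_empty, Nat.cast_zero]

/-- **THE FIBRE SUMS OF THE TABLE OF A SUM OF COORDINATE-LOCAL TERMS**: under the hypotheses of §3, for `s = 1` (middle index) or `s = 2`
(last index) — indeed any slot — and every `j`,
`Σ_{r : r s = j} |D³P(z)[e_{r0}, e_{r1}, e_{r2}]| ≤ Σ_p 1[j ∈ S_p]·|S_p|²·τ_p`. [folklore] -/
theorem fibreSum_localTerms_le (S : 𝔓 → Finset (Fin n))
    (π : (p : 𝔓) → (EuclideanSpace ℝ (Fin n) →L[ℝ] EuclideanSpace ℝ (S p)))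
    (hπ : ∀ p (v : EuclideanSpace ℝ (Fin n)) (i : S p), π p v i = v i) (Φ : (p : 𝔓) → EuclideanSpace ℝ (S p) → ℝ)
    (U : (p : 𝔓) → Set (EuclideanSpace ℝ (S p))) (hU : ∀ p, IsOpen (U p)) (hΦ : ∀ p, ContDiffOn ℝ 3 (Φ p) (U p))
    {z : EuclideanSpace ℝ (Fin n)} (hz : ∀ p, π p z ∈ U p) (τ : 𝔓 → ℝ) (hτ0 : ∀ p, 0 ≤ τ p)
    (hτ : ∀ p, ‖iteratedFDeriv ℝ 3 (Φ p) (π p z)‖ ≤ τ p) (s : Fin 3) (j : Fin n) :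
    ∑ r ∈ univ.filter (fun r : Fin 3 → Fin n => r s = j),
        |iteratedFDeriv ℝ 3 (fun x => ∑ p, Φ p (π p x)) z (fun t => EuclideanSpace.single (r t) (1 : ℝ))|
      ≤ ∑ p, (if j ∈ S p then (S p).card ^ 2 * τ p else 0) := by
  calc ∑ r ∈ univ.filter (fun r : Fin 3 → Fin n => r s = j),
          |iteratedFDeriv ℝ 3 (fun x => ∑ p, Φ p (π p x)) z (fun t => EuclideanSpace.single (r t) (1 : ℝ))|
        ≤ ∑ r ∈ univ.filter (fun r : Fin 3 → Fin n => r s = j), ∑ p ∈ univ.filter (fun p => ∀ t, r t ∈ S p), τ p :=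
          Finset.sum_le_sum fun r _ => abs_iteratedFDeriv_three_single_localTerms_le S π hπ Φ U hU hΦ hz τ hτ0 hτ r
    _ = ∑ p, ∑ r ∈ univ.filter (fun r : Fin 3 → Fin n => r s = j), (if (∀ t, r t ∈ S p) then τ p else 0) := by
          rw [Finset.sum_comm]
          refine Finset.sum_congr rfl fun r _ => ?_
          rw [Finset.sum_filter]
    _ = ∑ p, ((univ.filter (fun r : Fin 3 → Fin n => r s = j ∧ ∀ t, r t ∈ S p)).card : ℝ) * τ p := by
          refine Finset.sum_congr rfl fun p _ => ?_
          rw [← Finset.sum_filter, Finset.filter_filter, Finset.sum_const, nsmul_eq_mul]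
    _ ≤ ∑ p, (if j ∈ S p then (S p).card ^ 2 * τ p else 0) := by
          refine Finset.sum_le_sum fun p _ => ?_
          have hc := card_filter_triples_le (S p) s j
          split_ifs at hc ⊢ with hj
          · exact mul_le_mul_of_nonneg_right hc (hτ0 p)
          · have h0 : ((univ.filter (fun r : Fin 3 → Fin n => r s = j ∧ ∀ t, r t ∈ S p)).card : ℝ) = 0 :=
              le_antisymm hc (Nat.cast_nonneg _)
            rw [h0, zero_mul]

/-- **… UNIFORMLY**: `|S_p| ≤ s`, `0 ≤ τ_p ≤ τ` (`0 ≤ τ`), every coordinate in at most `d` supports ⟹ every fibre sum `≤ d·s²·τ` — INTENSIVE: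
the volume `n` and the number of terms do not enter. [folklore] -/
theorem fibreSum_localTerms_le_uniform (S : 𝔓 → Finset (Fin n))
    (π : (p : 𝔓) → (EuclideanSpace ℝ (Fin n) →L[ℝ] EuclideanSpace ℝ (S p)))
    (hπ : ∀ p (v : EuclideanSpace ℝ (Fin n)) (i : S p), π p v i = v i) (Φ : (p : 𝔓) → EuclideanSpace ℝ (S p) → ℝ)
    (U : (p : 𝔓) → Set (EuclideanSpace ℝ (S p))) (hU : ∀ p, IsOpen (U p)) (hΦ : ∀ p, ContDiffOn ℝ 3 (Φ p) (U p))
    {z : EuclideanSpace ℝ (Fin n)} (hz : ∀ p, π p z ∈ U p) (τ : 𝔓 → ℝ) (hτ0 : ∀ p, 0 ≤ τ p)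
    (hτ : ∀ p, ‖iteratedFDeriv ℝ 3 (Φ p) (π p z)‖ ≤ τ p) {smax τmax : ℝ} {d : ℕ} (hτmax0 : 0 ≤ τmax) (hτmax : ∀ p, τ p ≤ τmax)
    (hs : ∀ p, ((S p).card : ℝ) ≤ smax) (hd : ∀ i : Fin n, (univ.filter (fun p => i ∈ S p)).card ≤ d) (s : Fin 3) (j : Fin n) :
    ∑ r ∈ univ.filter (fun r : Fin 3 → Fin n => r s = j),
        |iteratedFDeriv ℝ 3 (fun x => ∑ p, Φ p (π p x)) z (fun t => EuclideanSpace.single (r t) (1 : ℝ))|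
      ≤ d * smax ^ 2 * τmax := by
  refine (fibreSum_localTerms_le S π hπ Φ U hU hΦ hz τ hτ0 hτ s j).trans ?_
  calc ∑ p, (if j ∈ S p then ((S p).card : ℝ) ^ 2 * τ p else 0) ≤ ∑ p, (if j ∈ S p then smax ^ 2 * τmax else 0) := by
        refine Finset.sum_le_sum fun p _ => ?_
        split_ifs with hj
        · have h1 : ((S p).card : ℝ) ^ 2 ≤ smax ^ 2 := pow_le_pow_left₀ (Nat.cast_nonneg _) (hs p) 2
          have h2 : smax ^ 2 * τ p ≤ smax ^ 2 * τmax := mul_le_mul_of_nonneg_left (hτmax p) (sq_nonneg _)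
          nlinarith [hτ0 p]
        · exact le_rfl
    _ = ((univ.filter (fun p => j ∈ S p)).card : ℝ) * (smax ^ 2 * τmax) := by
        rw [← Finset.sum_filter, Finset.sum_const, nsmul_eq_mul]
    _ ≤ d * (smax ^ 2 * τmax) := mul_le_mul_of_nonneg_right (by exact_mod_cast hd j) (mul_nonneg (sq_nonneg _) hτmax0)
    _ = d * smax ^ 2 * τmax := by ring

end Fibre

/-! ## §5 The reading letter of a sum of local terms, leaf-02's Schur test BY NAME -/

section Reading

variable {n : ℕ} {𝔓 : Type*} [Fintype 𝔓]

/-- **THE MIXED LETTER OF A SUM OF LOCAL TERMS IS INTENSIVE** (`c∞ = d·s²·τ`).  `P = Σ_p Φ_p ∘ π_p` with coordinate readings `π_p` of supports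
`S_p` (`|S_p| ≤ s`, every coordinate in at most `d` of them), `Φ_p ∈ C³(U_p)`; a window `K` read into every `U_p` (`π_p z ∈ U_p` for `z ∈ K`) on
which `‖D³Φ_p(π_p z)‖ ≤ τ_p ≤ τ` (`0 ≤ τ_p`, `0 ≤ τ`) ⟹ `‖D³P(z)[w,·,·]‖_op ≤ (d·s²·τ)·‖w‖_∞` for `z ∈ K` — the `hP3` letter of
`…WindowHessianFromThirdDerivReading` §4 ∕ `…ConvexWindowSuppliersBox` §1–§3 in the sup-norm reading, SUPPLIED from per-term data through
`…ConvexWindowSuppliersLocal.thirdDeriv_supNorm_of_fibreSums` BY NAME; `n` and the number of terms do not enter. [folklore] -/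
theorem thirdDeriv_supNorm_of_localTerms (S : 𝔓 → Finset (Fin n))
    (π : (p : 𝔓) → (EuclideanSpace ℝ (Fin n) →L[ℝ] EuclideanSpace ℝ (S p)))
    (hπ : ∀ p (v : EuclideanSpace ℝ (Fin n)) (i : S p), π p v i = v i) (Φ : (p : 𝔓) → EuclideanSpace ℝ (S p) → ℝ)
    (U : (p : 𝔓) → Set (EuclideanSpace ℝ (S p))) (hU : ∀ p, IsOpen (U p)) (hΦ : ∀ p, ContDiffOn ℝ 3 (Φ p) (U p))
    {K : Set (EuclideanSpace ℝ (Fin n))} (hK : ∀ z ∈ K, ∀ p, π p z ∈ U p) (τ : 𝔓 → ℝ) (hτ0 : ∀ p, 0 ≤ τ p)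
    (hτ : ∀ z ∈ K, ∀ p, ‖iteratedFDeriv ℝ 3 (Φ p) (π p z)‖ ≤ τ p) {smax τmax : ℝ} {d : ℕ} (hτmax0 : 0 ≤ τmax)
    (hτmax : ∀ p, τ p ≤ τmax) (hs : ∀ p, ((S p).card : ℝ) ≤ smax) (hd : ∀ i : Fin n, (univ.filter (fun p => i ∈ S p)).card ≤ d) :
    ∀ z ∈ K, ∀ w : EuclideanSpace ℝ (Fin n),
      ‖fderiv ℝ (iteratedFDeriv ℝ 2 (fun x => ∑ p, Φ p (π p x))) z w‖ ≤ (d * smax ^ 2 * τmax) * ‖WithLp.ofLp w‖ :=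
  thirdDeriv_supNorm_of_fibreSums (by positivity)
    (fun z hz j => fibreSum_localTerms_le_uniform S π hπ Φ U hU hΦ (hK z hz) τ hτ0 (hτ z hz) hτmax0 hτmax hs hd 1 j)
    (fun z hz k => fibreSum_localTerms_le_uniform S π hπ Φ U hU hΦ (hK z hz) τ hτ0 (hτ z hz) hτmax0 hτmax hs hd 2 k)

/-- The sum is `C³` on the window's natural open neighbourhood `{z | ∀ p, π_p z ∈ U_p}` — the `ContDiffOn ℝ 3 P U` hypothesis of
`…WindowHessianFromThirdDerivReading` §4, so that the junction there is one `exact` (its `hKU` being this file's `hK`). [folklore] -/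
theorem contDiffOn_three_localTerms (S : 𝔓 → Finset (Fin n))
    (π : (p : 𝔓) → (EuclideanSpace ℝ (Fin n) →L[ℝ] EuclideanSpace ℝ (S p))) (Φ : (p : 𝔓) → EuclideanSpace ℝ (S p) → ℝ)
    (U : (p : 𝔓) → Set (EuclideanSpace ℝ (S p))) (hU : ∀ p, IsOpen (U p)) (hΦ : ∀ p, ContDiffOn ℝ 3 (Φ p) (U p)) :
    IsOpen {z : EuclideanSpace ℝ (Fin n) | ∀ p, π p z ∈ U p} ∧
      ContDiffOn ℝ 3 (fun x => ∑ p, Φ p (π p x)) {z : EuclideanSpace ℝ (Fin n) | ∀ p, π p z ∈ U p} :=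
  ⟨isOpen_localDomain π U hU, contDiffOn_localTerms π Φ U hU hΦ⟩

end Reading

/-! ## §6 Toy check (kernel): the count of §4 on one term with full support — `|S|² = n²` triples through a middle index -/

example (j : Fin 2) :
    ((univ.filter (fun r : Fin 3 → Fin 2 => r 1 = j ∧ ∀ t, r t ∈ (univ : Finset (Fin 2)))).card : ℝ)
      ≤ (if j ∈ (univ : Finset (Fin 2)) then ((univ : Finset (Fin 2)).card : ℝ) ^ 2 else 0) :=
  card_filter_triples_le univ 1 j

end Summit.QuantumFields.BalabanUV.T4Continuum.NE7b.ThirdDerivLocalTerms
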